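import Summits.CriticalPhenomena.PercolationContinuityZ3.Theorems.PercNearOneGluingNoHeavyPcintChordMemKernelCert
import HarnessLib

/-!
# PCINT lane, kernel reduced-state B3r certificate `Z6B10` (bond, d = 6, memory τ = 10, 6192 state classes): table part 29

Cell `prim-pcint`, seat `prim-pcint-2` (gen 4); memo `run/shared/lean/prim/pcint/REDUCTIONS.md` §B3r and HANDOFF ("B3r on reduced states").
Does NOT build on p205010.  Data for `BondK.le_criticalProb_of_checkRowsB` (`…PcintChordMemKernelCert`): `p = 9290/100000`,
`s̄ = 99568/100000` (`s̄²+p² ≥ 1`), refund `r = 100434/100000` (`s̄·r ≥ 1`, `(1-p)·r ≤ 1`), `κ̄ = (100000+99568)/(2·100000)`, `λ = 99999/100000`;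
Collatz–Wielandt weights (scale 10⁹) from a power iteration (ρ ≈ 0.9997074), exact off-line max row ratio 0.9997073741 < λ.
Generated by work/gen/gen_b3r_kernel.py (prim-pcint-2 gen 4 folder; copy in run/shared/lean/prim/pcint/prim-pcint-2/kernel/); the kernel re-checks every row.
-/

noncomputable section

namespace Summit.CriticalPhenomena.PercolationContinuityZ3.Theorems.Pcint.ChordMemZ6B10

set_option maxRecDepth 8000 in
set_option maxHeartbeats 400000 in
/-- Certificate rows `[6188, 6192)` as a search tree. [folklore] -/
def t_6188_6192 : NawK.NT := (NawK.NT.node (NawK.NT.node (NawK.NT.node NawK.NT.leaf 6188 (735020628, [([-1,0,0,0,0,0], 1), ([-1,-1,0,0,0,0], 2), ([-1,-1,-1,0,0,0], 3), ([-1,-1,-1,-1,0,0], 4), ([0,-1,-1,-1,0,0], 5), ([0,0,-1,-1,0,0], 6), ([0,0,-1,-1,-1,0], 7), ([0,0,0,-1,-1,0], 8), ([0,0,0,0,-1,0], 9)], [some (1584, 0), none, some (1585, 2), some (1586, 3), some (1587, 4), some (3681, 5), some (1589, 6), some (6182, 7), some (1591, 8), none, some (1591, 10), some (1591, 11)]) NawK.NT.leaf)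 6189 (766083756, [([-1,0,0,0,0,0], 1), ([-1,-1,0,0,0,0], 2), ([-1,-1,-1,0,0,0], 3), ([-1,-1,-1,-1,0,0], 4), ([-1,-1,-1,-1,-1,0], 5), ([-1,0,-1,-1,-1,0], 6), ([0,0,-1,-1,-1,0], 7), ([0,0,0,-1,-1,0], 8), ([0,0,0,0,-1,0], 9)], [some (134, 0), none, some (135, 2), some (530, 3), some (137, 4), some (3684, 5), some (139, 6), some (6184, 7), some (141, 8), none, some (141, 10), some (141, 11)]) NawK.NT.leaf) 6190 (758038766, [([-1,0,0,0,0,0], 1), ([-1,-1,0,0,0,0], 2), ([-1,-1,-1,0,0,0], 3), ([-1,-1,-1,-1,0,0], 4), ([0,-1,-1,-1,0,0], 5), ([0,-1,-1,-1,-1,0], 6), ([0,0,-1,-1,-1,0], 7), ([0,0,0,-1,-1,0], 8), ([0,0,0,0,-1,0], 9)], [some (522, 0), none, some (523, 2), some (1602, 3), some (525, 4), some (3693, 5), some (527, 6), some (6188, 7), some (529, 8), none, some (529, 10), some (529, 11)]) (NawK.NT.node NawK.NT.leaf 6191 (765412694, [([-1,0,0,0,0,0], 1), ([-1,-1,0,0,0,0],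 2), ([-1,-1,-1,0,0,0], 3), ([-1,-1,-1,-1,0,0], 4), ([-1,-1,-1,-1,-1,0], 5), ([0,-1,-1,-1,-1,0], 6), ([0,0,-1,-1,-1,0], 7), ([0,0,0,-1,-1,0], 8), ([0,0,0,0,-1,0], 9)], [some (134, 0), none, some (135, 2), some (1606, 3), some (137, 4), some (3696, 5), some (139, 6), some (6190, 7), some (141, 8), none, some (141, 10), some (141, 11)]) NawK.NT.leaf))

end Summit.CriticalPhenomena.PercolationContinuityZ3.Theorems.Pcint.ChordMemZ6B10
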